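/-
Copyright (c) 2026. All rights reserved.
Released under Apache 2.0 license as described in the file LICENSE.
-/
import Literature.NumberTheory.ComplexMultiplication.DegenerateCMTypesAbelianKernelsIndexFour
import Literature.NumberTheory.ComplexMultiplication.DegenerateCMTypesAbelianPrimePower
import Literature.NumberTheory.NumberFields.CyclotomicGaussianIndependence
import HarnessLib

/-!
# Kubota's defect by kernels IV: kernels of INDEX `4p` (`p` an odd prime) — the characters of a cyclic quotient of
# order `4p` vanish on a CM type iff the type is EQUIDISTRIBUTED along the `p`-torsion of the quotient

T. Kubota, *On the field extension by complex multiplication*, Trans. AMS 118 (1965) [Kubota1965], §4 LEMMA 2: the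
defect `|G|/2 + 1 − rank(S)` of a CM type `S` of a finite abelian group `G` (complex conjugation `ρ`) is the number of odd
characters vanishing on `S`.  The tree groups these characters by KERNEL (`DegenerateCMTypesAbelianKernels`:
`typeRank_add_sum_totient_eq`, `rank(S) + Σ_H φ([G:H]) = |G|/2 + 1` over the subgroups `H ∌ ρ` with `G/H` cyclic whose
characters vanish on `S`, all or none per kernel) and DECIDES the vanishing at the kernels of index `2` (even split), of
index `2p^{a+1}` (`…equidistributed_of_index`: equidistribution along the `p`-torsion, F. Hazama's Lemma 4.6.1 mechanism
[Hazama2003CyclicCM]) and of index `4` (`DegenerateCMTypesAbelianKernelsIndexFour`: half of every coset).  THIS FILE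
decides the kernels of INDEX `4p` — on a CM field: the CM subfields `F = K^H` with `Gal(F/ℚ) ≅ ℤ/4p` CYCLIC — which,
with the three decided cases, exhausts the admissible kernels of every abelian group of EXPONENT `4p`
(`ℤ/2 × ℤ/4 × ℤ/3 ≅ (ℤ/35)ˣ, (ℤ/39)ˣ, (ℤ/45)ˣ, (ℤ/52)ˣ, (ℤ/70)ˣ, (ℤ/78)ˣ, (ℤ/90)ˣ`, the second half of the
`φ = 24` band; the rank formula is the sequel `Pohlmann1968/DegenerateCMTypesAbelianCMFieldExponentFourTimesPrime`).

* §1 **`sum_char_eq_sum_gaussian_fibres`** — for a character `χ` with values in the `4p`-th roots of unity and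
  `ω = χ(u)` a primitive `p`-th root of unity, every value is `ε·ω^d` with `ε ∈ {1, −1, i, −i}`, `d ∈ ℤ/p`
  (`μ_{4p} = μ₄ · μ_p`, `p` odd), and `χ(S) = Σ_{d ∈ ℤ/p} ((N(ω^d) − N(−ω^d)) + (N(iω^d) − N(−iω^d))·i)·ω^d` with
  `N(v) = #{s ∈ S : χ(s) = v}`.  **`sum_char_eq_zero_iff_fibres_four_mul`** — for an ODD such `χ` (`χ(ρ) = −1`) and a CM
  type `S` (`S ⊔ ρS = G`): `χ(S) = 0 ⟺ N(χ(g)·ω) = N(χ(g))` for every `g` — the fibre counts are constant along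
  multiplication by `ω`.  PROOF (⇒): the `ℤ[i]`-linear relations among `1, ω, …, ω^{p−1}` are the multiples of
  `Σ_d ω^d` (`i ∉ ℚ(ω)`; tree `CyclotomicGaussian.eq_of_sum_gaussian_mul_pow_eq_zero`, [Washington1997] Prop. 2.4 /
  Thm. 2.5), so both Gaussian coordinates `N(ω^d) − N(−ω^d)`, `N(iω^d) − N(−iω^d)` are constant in `d`; with
  `N(v) + N(−v) = #χ⁻¹(v)` (`χ(ρs) = −χ(s)`, `S ⊔ ρS = G`; tree `AbelianPrimePow.card_filter_neg`) and
  `#χ⁻¹(vω^d) = #χ⁻¹(v)` all four counts are constant in `d`.  (⇐): `ω·χ(S) = χ(uS) = Σ_v N(vω⁻¹)·v = χ(S)`, `ω ≠ 1`.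
* §2 **`sum_char_eq_zero_iff_equidistributed_of_index_four_mul`** — COSET FORM: for `χ` odd with `ker χ = H` of index
  `4p` and `G/H` cyclic, `χ(S) = 0 ⟺ #(S ∩ gxH) = #(S ∩ gH)` for all `g ∈ G` and all `x` with `x^p ∈ H` — verbatim the
  condition of the index-`2p` kernels (tree `…equidistributed_of_index`); **`forall_sum_char_eq_zero_iff_equidistributed_
  of_index_four_mul`** — all `φ(4p) = 2(p − 1)` characters of kernel `H` at once (so `H` contributes `2(p−1)` to Kubota's
  defect iff `S` is equidistributed at `H`).

HONEST SCOPE.  A regrouping of Kubota's count (kernels of index `4p`), assembled from the tree's index-`2p^{a+1}` tools and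
the `ℚ(i)`-independence of the `p`-th roots of unity; not a printed formula — the printed ingredients are cited at each
statement.  Nothing is claimed about which index-`4p` subgroups have cyclic quotient (in exponent `4p` the quotient by an
index-`4p` subgroup may be `ℤ/2 × ℤ/2p`; the sequel carries `IsCyclic (G ⧸ H)` explicitly).  THEOREMS ONLY: no definition,
no named fact, no instance, no notation, no `sorry` (D-0026 net debt 0).  HC_CM is NOT proved; nothing here bears on it
beyond the degenerate/non-degenerate census of CM types.

## References

* [Kubota1965] T. Kubota, Trans. AMS 118 (1965), §4 Lemma 2 (held text, p. 119): defect = number of vanishing odd characters.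
* [Hazama2003CyclicCM] F. Hazama, *Hodge cycles on abelian varieties with complex multiplication by cyclic CM-fields*,
  J. Math. Sci. Univ. Tokyo 10 (2003), Prop. 4.1 (character sums on fibres), Prop. 4.3, Lemma 4.6.1 (equidistribution).
* [Washington1997] L. C. Washington, *Introduction to Cyclotomic Fields*, 2nd ed., GTM 83, Prop. 2.4, Thm. 2.5
  (`[ℚ(ζ_{4p}) : ℚ(i)] = p − 1`: the `ℚ(i)`-relations among `1, ζ_p, …, ζ_p^{p−1}`).
* [White1993SporadicCycles] S. P. White, Compositio Math. 88 (1993), §4, proof of Lemma 3 (p. 131) (grouping by kernels).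
* [Gordon1999HodgeAVSurvey] B. B. Gordon, *A survey of the Hodge conjecture for abelian varieties*, 9.4.3 (Yanai's criterion
  over a cyclic CM subquotient — the shape of the coset condition).

## Provenance

pub-hodgecm2 (COR-CM), KEPT Literature lane `lit-deligne-3`, generation 64, file F64b-1 (the `φ = 24` band, second half:
exponent `4p`).  Neighbours cited by name, nothing restated: `DegenerateCMTypesAbelianKernels` (`forall_sum_char_eq_zero_
iff_exists`, `exists_oddChar_ker`), `DegenerateCMTypesAbelianPrimePower` (`AbelianPrimePow.card_filter_neg`,
`card_fibre_mul`), `CyclotomicGaussianIndependence` (`eq_of_sum_gaussian_mul_pow_eq_zero`).  The `[folklore]` helpers are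
private (the fourth roots of unity in `ℂ`: the tree proves the same list in `WeilClassesFieldSplitSquareZetaEight.eq_of_pow_
four_eq_one`, not imported here to keep the group-theoretic layer free of Hodge theory).
-/

noncomputable section

open scoped BigOperators Classical

namespace Literature.NumberTheory.ComplexMultiplication

namespace CyclicCMType

namespace AbelianKernels

open Literature.NumberTheory.NumberFields.CyclotomicGaussian (eq_of_sum_gaussian_mul_pow_eq_zero)

variable {G : Type*} [CommGroup G] [Fintype G] [DecidableEq G] {ρ : G} {Φ : Finset G} {p : ℕ}

/-! ## §0 Helpers -/

section Helpers

omit [Fintype G] [DecidableEq G] in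
/-- `χ(gh) = χ(g)χ(h)`. [folklore] -/
private theorem char_mul₄ₚ (χ : AddChar (Additive G) ℂ) (g h : G) :
    χ (Additive.ofMul (g * h)) = χ (Additive.ofMul g) * χ (Additive.ofMul h) := by
  rw [ofMul_mul, AddChar.map_add_eq_mul]

omit [Fintype G] [DecidableEq G] in
/-- `χ(g^e) = χ(g)^e`. [folklore] -/
private theorem char_pow₄ₚ (χ : AddChar (Additive G) ℂ) (g : G) (e : ℕ) :
    χ (Additive.ofMul (g ^ e)) = χ (Additive.ofMul g) ^ e := by
  rw [ofMul_pow, AddChar.map_nsmul_eq_pow]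

omit [Fintype G] [DecidableEq G] in
/-- `χ(1) = 1`. [folklore] -/
private theorem char_one₄ₚ (χ : AddChar (Additive G) ℂ) : χ (Additive.ofMul (1 : G)) = 1 := by
  rw [ofMul_one, AddChar.map_zero_eq_one]

omit [Fintype G] [DecidableEq G] in
/-- `χ(g) ≠ 0`. [folklore] -/
private theorem char_ne_zero₄ₚ (χ : AddChar (Additive G) ℂ) (g : G) : χ (Additive.ofMul g) ≠ 0 := by
  intro h0
  have := char_mul₄ₚ χ g g⁻¹
  rw [mul_inv_cancel, char_one₄ₚ, h0, zero_mul] at this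
  exact one_ne_zero this

omit [Fintype G] [DecidableEq G] in
/-- `χ(s) = χ(g)` iff `g⁻¹s ∈ ker χ`. [folklore] -/
private theorem char_eq_iff_inv_mul_mem₄ₚ {H : Subgroup G} (χ : AddChar (Additive G) ℂ)
    (hker : ∀ g : G, χ (Additive.ofMul g) = 1 ↔ g ∈ H) (g s : G) :
    χ (Additive.ofMul s) = χ (Additive.ofMul g) ↔ g⁻¹ * s ∈ H := by
  rw [← hker]
  have h1 : χ (Additive.ofMul (g⁻¹ * s)) * χ (Additive.ofMul g) = χ (Additive.ofMul s) := by
    rw [← char_mul₄ₚ, mul_comm g⁻¹ s, inv_mul_cancel_right]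
  constructor
  · intro hs
    rw [hs] at h1
    exact mul_left_eq_self₀.1 h1 |>.resolve_right (char_ne_zero₄ₚ χ g)
  · intro h
    rw [h, one_mul] at h1
    exact h1.symm

omit [Fintype G] [DecidableEq G] in
/-- `ρ² = 1` for the conjugation of a CM type. [folklore] -/
private theorem rho_mul_rho₄ₚ (h : IsCMTypeWith ρ (Φ : Set G)) : ρ * ρ = 1 := by
  simpa [smul_eq_mul] using h.invol (1 : G)

/-- **The fourth roots of unity in `ℂ`** are `1, −1, i, −i`. [folklore] -/
private theorem eq_of_pow_four_eq_one₄ₚ {z : ℂ} (hz : z ^ 4 = 1) :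
    z = 1 ∨ z = -1 ∨ z = Complex.I ∨ z = -Complex.I := by
  have key : (z - 1) * (z + 1) * (z - Complex.I) * (z + Complex.I) = z ^ 4 - 1 := by
    linear_combination (1 - z ^ 2) * Complex.I_sq
  rw [hz, sub_self] at key
  rcases mul_eq_zero.mp key with h | h
  · rcases mul_eq_zero.mp h with h | h
    · rcases mul_eq_zero.mp h with h | h
      · exact Or.inl (sub_eq_zero.mp h)
      · exact Or.inr (Or.inl (add_eq_zero_iff_eq_neg.mp h))
    · exact Or.inr (Or.inr (Or.inl (sub_eq_zero.mp h)))
  · exact Or.inr (Or.inr (Or.inr (add_eq_zero_iff_eq_neg.mp h)))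

end Helpers

/-! ## §1 Characters with values in the `4p`-th roots of unity: the values `ε·ω^d` and the character sum on the fibres -/

section Values

variable [hp : Fact p.Prime] {u : G} {χ : AddChar (Additive G) ℂ}

omit [Fintype G] [DecidableEq G] in
/-- `ω^{(d + m).val} = ω^{d.val} · ω^m` for `ω = χ(u)` a primitive `p`-th root of unity. [folklore] -/
private theorem pow_val_add₄ₚ (hu : IsPrimitiveRoot (χ (Additive.ofMul u)) p) (d : ZMod p) (m : ℕ) :
    χ (Additive.ofMul u) ^ (d + (m : ZMod p)).val = χ (Additive.ofMul u) ^ d.val * χ (Additive.ofMul u) ^ m := by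
  have h1 := pow_mod_orderOf (χ (Additive.ofMul u)) (d.val + m % p)
  have h2 := pow_mod_orderOf (χ (Additive.ofMul u)) m
  rw [← hu.eq_orderOf] at h1 h2
  rw [ZMod.val_add, ZMod.val_natCast, h1, pow_add, h2]

omit [Fintype G] [DecidableEq G] in
/-- `ε ω^a = ε' ω^b` with `ε⁴ = ε'⁴ = 1` forces `a = b` (`p` odd: `μ₄ ∩ μ_p = 1`, and `4` is invertible mod `p`). [folklore] -/
private theorem zmod_eq_of_mul_pow_eq₄ₚ (hp2 : p ≠ 2) (hu : IsPrimitiveRoot (χ (Additive.ofMul u)) p) {ε ε' : ℂ}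
    (hε : ε ^ 4 = 1) (hε' : ε' ^ 4 = 1) {a b : ZMod p}
    (h : ε * χ (Additive.ofMul u) ^ a.val = ε' * χ (Additive.ofMul u) ^ b.val) : a = b := by
  set ω := χ (Additive.ofMul u) with hω
  have h4 : ω ^ (4 * a.val) = ω ^ (4 * b.val) := by
    have := congrArg (· ^ 4) h
    simp only [mul_pow, hε, hε', one_mul, ← pow_mul, mul_comm _ 4] at this
    exact this
  -- `4 a ≡ 4 b (mod p)`, hence `a = b`
  have hmod : 4 * a.val ≡ 4 * b.val [MOD p] := by
    have h1 := pow_mod_orderOf ω (4 * a.val)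
    have h2 := pow_mod_orderOf ω (4 * b.val)
    rw [← hu.eq_orderOf] at h1 h2
    rw [← h1, ← h2] at h4
    exact hu.pow_inj (Nat.mod_lt _ hp.out.pos) (Nat.mod_lt _ hp.out.pos) h4
  have hz : ((4 * a.val : ℕ) : ZMod p) = ((4 * b.val : ℕ) : ZMod p) := (ZMod.natCast_eq_natCast_iff _ _ _).2 hmod
  push_cast at hz
  rw [ZMod.natCast_zmod_val, ZMod.natCast_zmod_val] at hz
  have h4u : IsUnit ((4 : ℕ) : ZMod p) := by
    rw [ZMod.isUnit_iff_coprime]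
    have h2 : Nat.Coprime 2 p := (Nat.coprime_primes Nat.prime_two hp.out).2 (Ne.symm hp2)
    simpa using h2.pow_left 2
  have h4u' : IsUnit (4 : ZMod p) := by exact_mod_cast h4u
  exact h4u'.mul_left_cancel hz

omit [Fintype G] [DecidableEq G] in
/-- **The values of `χ` are `ε·ω^d`** with `ε ∈ {1, −1, i, −i}` and `d ∈ ℤ/p`, when `ω = χ(u)` is a primitive `p`-th root of
unity and all values are `4p`-th roots of unity (`p` odd). [folklore] -/
private theorem exists_value_eq₄ₚ (hp2 : p ≠ 2) (hu : IsPrimitiveRoot (χ (Additive.ofMul u)) p)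
    (hall : ∀ g : G, χ (Additive.ofMul g) ^ (4 * p) = 1) (g : G) :
    ∃ ε : ℂ, (ε = 1 ∨ ε = -1 ∨ ε = Complex.I ∨ ε = -Complex.I) ∧
      ∃ d : ZMod p, χ (Additive.ofMul g) = ε * χ (Additive.ofMul u) ^ d.val := by
  set w := χ (Additive.ofMul g) with hw
  set ω := χ (Additive.ofMul u) with hω
  have hω0 : ω ≠ 0 := hu.ne_zero hp.out.ne_zero
  -- `w⁴` is a `p`-th root of unity: `w⁴ = ω^e`
  have h4p : (w ^ 4) ^ p = 1 := by rw [← pow_mul]; exact hall g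
  obtain ⟨e, -, he⟩ := hu.eq_pow_of_pow_eq_one h4p
  -- `d := e / 4` in `ℤ/p`
  have h4u : IsUnit ((4 : ℕ) : ZMod p) := by
    rw [ZMod.isUnit_iff_coprime]
    have h2 : Nat.Coprime 2 p := (Nat.coprime_primes Nat.prime_two hp.out).2 (Ne.symm hp2)
    simpa using h2.pow_left 2
  obtain ⟨q, hq⟩ := h4u
  set d : ZMod p := (e : ZMod p) * (↑q⁻¹ : ZMod p) with hd
  have h4d : (4 : ZMod p) * d = (e : ZMod p) := by
    rw [hd, ← mul_assoc, mul_comm (4 : ZMod p), mul_assoc]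
    have : (q : ZMod p) = 4 := by exact_mod_cast hq
    rw [← this, Units.mul_inv, mul_one]
  have hval : ω ^ (4 * d.val) = ω ^ e := by
    rw [← pow_mod_orderOf ω (4 * d.val), ← pow_mod_orderOf ω e, ← hu.eq_orderOf]
    congr 1
    have hz : ((4 * d.val : ℕ) : ZMod p) = (e : ZMod p) := by
      push_cast
      rw [ZMod.natCast_zmod_val]
      exact h4d
    exact (ZMod.natCast_eq_natCast_iff' _ _ _).1 hz
  -- `z := w / ω^d` is a fourth root of unity
  set z := w * (ω ^ d.val)⁻¹ with hz
  have hzpow : z ^ 4 = 1 := by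
    rw [hz, mul_pow, ← he, ← hval, inv_pow, ← pow_mul, mul_comm d.val 4, mul_inv_cancel₀]
    exact pow_ne_zero _ hω0
  refine ⟨z, eq_of_pow_four_eq_one₄ₚ hzpow, d, ?_⟩
  rw [hz, inv_mul_cancel_right₀ (pow_ne_zero _ hω0)]

omit [Fintype G] [DecidableEq G] in
/-- Distinctness of `1, −1, i, −i`. [folklore] -/
private theorem four_roots_distinct₄ₚ :
    (1 : ℂ) ≠ -1 ∧ (1 : ℂ) ≠ Complex.I ∧ (1 : ℂ) ≠ -Complex.I ∧ (-1 : ℂ) ≠ Complex.I ∧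
      (-1 : ℂ) ≠ -Complex.I ∧ Complex.I ≠ -Complex.I := by
  refine ⟨by norm_num, fun h => ?_, fun h => ?_, fun h => ?_, fun h => ?_, fun h => ?_⟩
  · have := congrArg Complex.re h; norm_num at this
  · have := congrArg Complex.re h; norm_num at this
  · have := congrArg Complex.re h; norm_num at this
  · have := congrArg Complex.re h; norm_num at this
  · have := congrArg Complex.im h; norm_num at this

omit [Fintype G] [DecidableEq G] in
/-- **The character sum on the fibres**: `χ(S) = Σ_{d ∈ ℤ/p} ((N(ω^d) − N(−ω^d)) + (N(iω^d) − N(−iω^d))·i)·ω^d` with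
`N(v) = #{s ∈ S : χ(s) = v}`, for `χ` with values in the `4p`-th roots of unity and `ω = χ(u)` a primitive `p`-th root.
[cite: Kubota1965, §4 Lemma 2 (proof)] [cite: Hazama2003CyclicCM, Prop. 4.1] -/
theorem sum_char_eq_sum_gaussian_fibres (hp2 : p ≠ 2) (hu : IsPrimitiveRoot (χ (Additive.ofMul u)) p)
    (hall : ∀ g : G, χ (Additive.ofMul g) ^ (4 * p) = 1) (Φ : Finset G) :
    ∑ s ∈ Φ, χ (Additive.ofMul s) = ∑ d : ZMod p,
      ((((Φ.filter fun s => χ (Additive.ofMul s) = χ (Additive.ofMul u) ^ d.val).card : ℂ) -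
          ((Φ.filter fun s => χ (Additive.ofMul s) = -χ (Additive.ofMul u) ^ d.val).card : ℂ)) +
        (((Φ.filter fun s => χ (Additive.ofMul s) = Complex.I * χ (Additive.ofMul u) ^ d.val).card : ℂ) -
          ((Φ.filter fun s => χ (Additive.ofMul s) = -(Complex.I * χ (Additive.ofMul u) ^ d.val)).card : ℂ)) *
          Complex.I) * χ (Additive.ofMul u) ^ d.val := by
  set ω := χ (Additive.ofMul u) with hωdef
  obtain ⟨d1, d2, d3, d4, d5, d6⟩ := four_roots_distinct₄ₚ
  -- pointwise: exactly one of the `4p` indicator terms is `χ(s)`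
  have hpt : ∀ s : G, χ (Additive.ofMul s) = ∑ d : ZMod p,
      ((if χ (Additive.ofMul s) = ω ^ d.val then ω ^ d.val else 0) +
        (if χ (Additive.ofMul s) = -ω ^ d.val then -ω ^ d.val else 0) +
        (if χ (Additive.ofMul s) = Complex.I * ω ^ d.val then Complex.I * ω ^ d.val else 0) +
        (if χ (Additive.ofMul s) = -(Complex.I * ω ^ d.val) then -(Complex.I * ω ^ d.val) else 0)) := by
    intro s
    obtain ⟨ε, hε, d₀, hd₀⟩ := exists_value_eq₄ₚ hp2 hu hall s
    have hd₀' : χ (Additive.ofMul s) = ε * ω ^ d₀.val := hd₀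
    have hε4 : ε ^ 4 = 1 := by
      rcases hε with rfl | rfl | rfl | rfl <;> norm_num [Complex.I_pow_four, neg_pow]
    -- `χ(s) = ε' ω^d` iff `(ε', d) = (ε, d₀)`
    have key : ∀ ε' : ℂ, ε' ^ 4 = 1 → ∀ d : ZMod p,
        (χ (Additive.ofMul s) = ε' * ω ^ d.val ↔ ε' = ε ∧ d = d₀) := by
      intro ε' hε'4 d
      constructor
      · intro h'
        rw [hd₀'] at h'
        have hdd : d₀ = d := zmod_eq_of_mul_pow_eq₄ₚ hp2 hu hε4 hε'4 h'
        subst hdd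
        exact ⟨(mul_right_cancel₀ (pow_ne_zero _ (hu.ne_zero hp.out.ne_zero)) h').symm, rfl⟩
      · rintro ⟨rfl, rfl⟩; exact hd₀'
    have key1 : ∀ d : ZMod p, (χ (Additive.ofMul s) = ω ^ d.val ↔ 1 = ε ∧ d = d₀) := fun d => by
      rw [← one_mul (ω ^ d.val)]; exact key 1 (one_pow 4) d
    have key2 : ∀ d : ZMod p, (χ (Additive.ofMul s) = -ω ^ d.val ↔ -1 = ε ∧ d = d₀) := fun d => by
      rw [← neg_one_mul (ω ^ d.val)]; exact key (-1) (by norm_num) d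
    have key3 : ∀ d : ZMod p, (χ (Additive.ofMul s) = Complex.I * ω ^ d.val ↔ Complex.I = ε ∧ d = d₀) := fun d =>
      key Complex.I Complex.I_pow_four d
    have key4 : ∀ d : ZMod p, (χ (Additive.ofMul s) = -(Complex.I * ω ^ d.val) ↔ -Complex.I = ε ∧ d = d₀) :=
      fun d => by
      rw [← neg_mul]; exact key (-Complex.I) (by rw [neg_pow, Complex.I_pow_four]; norm_num) d
    simp_rw [key1, key2, key3, key4]
    rw [Finset.sum_eq_single d₀]
    · rcases hε with rfl | rfl | rfl | rfl
      · rw [if_pos (show (1 : ℂ) = 1 ∧ d₀ = d₀ from ⟨rfl, rfl⟩),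
          if_neg (show ¬((-1 : ℂ) = 1 ∧ d₀ = d₀) from fun h => d1 h.1.symm),
          if_neg (show ¬(Complex.I = 1 ∧ d₀ = d₀) from fun h => d2 h.1.symm),
          if_neg (show ¬(-Complex.I = 1 ∧ d₀ = d₀) from fun h => d3 h.1.symm), hd₀']
        ring
      · rw [if_neg (show ¬((1 : ℂ) = -1 ∧ d₀ = d₀) from fun h => d1 h.1),
          if_pos (show (-1 : ℂ) = -1 ∧ d₀ = d₀ from ⟨rfl, rfl⟩),
          if_neg (show ¬(Complex.I = -1 ∧ d₀ = d₀) from fun h => d4 h.1.symm),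
          if_neg (show ¬(-Complex.I = -1 ∧ d₀ = d₀) from fun h => d5 h.1.symm), hd₀']
        ring
      · rw [if_neg (show ¬((1 : ℂ) = Complex.I ∧ d₀ = d₀) from fun h => d2 h.1),
          if_neg (show ¬((-1 : ℂ) = Complex.I ∧ d₀ = d₀) from fun h => d4 h.1),
          if_pos (show Complex.I = Complex.I ∧ d₀ = d₀ from ⟨rfl, rfl⟩),
          if_neg (show ¬(-Complex.I = Complex.I ∧ d₀ = d₀) from fun h => d6 h.1.symm), hd₀']
        ring
      · rw [if_neg (show ¬((1 : ℂ) = -Complex.I ∧ d₀ = d₀) from fun h => d3 h.1),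
          if_neg (show ¬((-1 : ℂ) = -Complex.I ∧ d₀ = d₀) from fun h => d5 h.1),
          if_neg (show ¬(Complex.I = -Complex.I ∧ d₀ = d₀) from fun h => d6 h.1),
          if_pos (show -Complex.I = -Complex.I ∧ d₀ = d₀ from ⟨rfl, rfl⟩), hd₀']
        ring
    · intro d _ hd
      have hF : ∀ ε' : ℂ, ¬(ε' = ε ∧ d = d₀) := fun ε' h => hd h.2
      rw [if_neg (hF 1), if_neg (hF (-1)), if_neg (hF Complex.I), if_neg (hF (-Complex.I))]
      ring
    · intro h'; exact absurd (Finset.mem_univ _) h'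
  rw [Finset.sum_congr rfl fun s _ => hpt s, Finset.sum_comm]
  refine Finset.sum_congr rfl fun d _ => ?_
  rw [Finset.sum_add_distrib, Finset.sum_add_distrib, Finset.sum_add_distrib, ← Finset.sum_filter, ← Finset.sum_filter,
    ← Finset.sum_filter, ← Finset.sum_filter, Finset.sum_const, Finset.sum_const, Finset.sum_const, Finset.sum_const,
    nsmul_eq_mul, nsmul_eq_mul, nsmul_eq_mul, nsmul_eq_mul]
  ring

/-- **THE VANISHING CRITERION ON THE FIBRES FOR VALUES IN THE `4p`-TH ROOTS OF UNITY** (any finite abelian group, `p` odd):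
for an odd character `χ` (`χ(ρ) = −1`) whose values are `4p`-th roots of unity and contain a primitive `p`-th root of unity
`ω = χ(u)`, `χ(S) = 0` for a CM type `S` iff `S` meets the fibres `χ⁻¹(v)` and `χ⁻¹(vω)` in equally many points for every value
`v = χ(g)` — `S` is EQUIDISTRIBUTED along the `p`-torsion `⟨u⟩·ker χ / ker χ` of `G/ker χ`.  (The `ℚ(i)`-linear relations among
`1, ω, …, ω^{p−1}` are the multiples of `Σ_d ω^d = 0`, tree `CyclotomicGaussian.eq_of_sum_gaussian_mul_pow_eq_zero`; the converse:
equidistribution gives `ω·χ(S) = χ(uS) = χ(S)`.)  The `2p^{a+1}` analogue is the tree's `AbelianPrimePow.sum_char_eq_zero_iff_fibres`.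
[cite: Kubota1965, §4 Lemma 2] [cite: Hazama2003CyclicCM, Prop. 4.3 and Lemma 4.6.1] [cite: Washington1997, Prop. 2.4 and Thm. 2.5] -/
theorem sum_char_eq_zero_iff_fibres_four_mul (hp2 : p ≠ 2) (h : IsCMTypeWith ρ (Φ : Set G))
    (hχ : χ (Additive.ofMul ρ) = -1) (hu : IsPrimitiveRoot (χ (Additive.ofMul u)) p)
    (hall : ∀ g : G, χ (Additive.ofMul g) ^ (4 * p) = 1) :
    ∑ s ∈ Φ, χ (Additive.ofMul s) = 0 ↔ ∀ g : G,
      (Φ.filter fun s => χ (Additive.ofMul s) = χ (Additive.ofMul g) * χ (Additive.ofMul u)).card =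
        (Φ.filter fun s => χ (Additive.ofMul s) = χ (Additive.ofMul g)).card := by
  have hω1 : χ (Additive.ofMul u) ≠ 1 := hu.ne_one hp.out.one_lt
  constructor
  · intro h0 g
    -- the Gaussian coefficients are constant in `d`
    have hsum := sum_char_eq_sum_gaussian_fibres hp2 hu hall Φ
    obtain ⟨hxc, hyc⟩ := eq_of_sum_gaussian_mul_pow_eq_zero hp2 hu
      (fun d => ((Φ.filter fun s => χ (Additive.ofMul s) = χ (Additive.ofMul u) ^ d.val).card : ℤ) -
        ((Φ.filter fun s => χ (Additive.ofMul s) = -χ (Additive.ofMul u) ^ d.val).card : ℤ))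
      (fun d => ((Φ.filter fun s => χ (Additive.ofMul s) = Complex.I * χ (Additive.ofMul u) ^ d.val).card : ℤ) -
        ((Φ.filter fun s => χ (Additive.ofMul s) = -(Complex.I * χ (Additive.ofMul u) ^ d.val)).card : ℤ))
      (by rw [← h0, hsum]; exact Finset.sum_congr rfl fun d _ => by push_cast; ring)
    -- the opposite fibres: `N(−v) = M_v − N(v)` with `M_v` the fibre size, constant along the four families
    have hneg : ∀ v : ℂ, (Φ.filter fun s => χ (Additive.ofMul s) = -v).card =
        (Finset.univ.filter fun t : G => χ (Additive.ofMul t) = v).card -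
          (Φ.filter fun s => χ (Additive.ofMul s) = v).card := fun v =>
      AbelianPrimePow.card_filter_neg h χ hχ v
    have hM1 : ∀ d : ZMod p, (Finset.univ.filter fun t : G => χ (Additive.ofMul t) = χ (Additive.ofMul u) ^ d.val).card =
        (Finset.univ.filter fun t : G => χ (Additive.ofMul t) = 1).card := fun d => by
      rw [← AbelianPrimePow.card_fibre_mul χ (u ^ d.val) 1, char_pow₄ₚ, mul_one]
    have hMI : ∀ d : ZMod p,
        (Finset.univ.filter fun t : G => χ (Additive.ofMul t) = Complex.I * χ (Additive.ofMul u) ^ d.val).card =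
          (Finset.univ.filter fun t : G => χ (Additive.ofMul t) = Complex.I).card := fun d => by
      rw [mul_comm, ← AbelianPrimePow.card_fibre_mul χ (u ^ d.val) Complex.I, char_pow₄ₚ]
    -- hence all four fibre counts are constant in `d`
    have hN1 : ∀ d : ZMod p, (Φ.filter fun s => χ (Additive.ofMul s) = χ (Additive.ofMul u) ^ d.val).card =
        (Φ.filter fun s => χ (Additive.ofMul s) = χ (Additive.ofMul u) ^ (0 : ZMod p).val).card := by
      intro d
      have h1 := hxc d
      beta_reduce at h1
      have h2 := hneg (χ (Additive.ofMul u) ^ d.val); have h3 := hneg (χ (Additive.ofMul u) ^ (0 : ZMod p).val)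
      rw [hM1] at h2 h3
      omega
    have hN2 : ∀ d : ZMod p, (Φ.filter fun s => χ (Additive.ofMul s) = -χ (Additive.ofMul u) ^ d.val).card =
        (Φ.filter fun s => χ (Additive.ofMul s) = -χ (Additive.ofMul u) ^ (0 : ZMod p).val).card := by
      intro d
      have h2 := hneg (χ (Additive.ofMul u) ^ d.val); have h3 := hneg (χ (Additive.ofMul u) ^ (0 : ZMod p).val)
      rw [hM1] at h2 h3
      rw [h2, h3, hN1 d]
    have hN3 : ∀ d : ZMod p,
        (Φ.filter fun s => χ (Additive.ofMul s) = Complex.I * χ (Additive.ofMul u) ^ d.val).card =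
          (Φ.filter fun s => χ (Additive.ofMul s) = Complex.I * χ (Additive.ofMul u) ^ (0 : ZMod p).val).card := by
      intro d
      have h1 := hyc d
      beta_reduce at h1
      have h2 := hneg (Complex.I * χ (Additive.ofMul u) ^ d.val)
      have h3 := hneg (Complex.I * χ (Additive.ofMul u) ^ (0 : ZMod p).val)
      rw [hMI] at h2 h3
      omega
    have hN4 : ∀ d : ZMod p,
        (Φ.filter fun s => χ (Additive.ofMul s) = -(Complex.I * χ (Additive.ofMul u) ^ d.val)).card =
          (Φ.filter fun s => χ (Additive.ofMul s) = -(Complex.I * χ (Additive.ofMul u) ^ (0 : ZMod p).val)).card := by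
      intro d
      have h2 := hneg (Complex.I * χ (Additive.ofMul u) ^ d.val)
      have h3 := hneg (Complex.I * χ (Additive.ofMul u) ^ (0 : ZMod p).val)
      rw [hMI] at h2 h3
      rw [h2, h3, hN3 d]
    -- decompose `χ(g) = ε ω^d`; then `χ(g) ω = ε ω^{d+1}`
    obtain ⟨ε, hε, d, hd⟩ := exists_value_eq₄ₚ hp2 hu hall g
    have hshift : χ (Additive.ofMul g) * χ (Additive.ofMul u) = ε * χ (Additive.ofMul u) ^ (d + ((1 : ℕ) : ZMod p)).val := by
      rw [hd, pow_val_add₄ₚ hu d 1, pow_one, mul_assoc]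
    rw [hshift, hd]
    rcases hε with rfl | rfl | rfl | rfl
    · rw [one_mul, one_mul, hN1, hN1 d]
    · rw [neg_one_mul, neg_one_mul, hN2, hN2 d]
    · rw [hN3, hN3 d]
    · rw [neg_mul, neg_mul, hN4, hN4 d]
  · intro hE
    -- `ω · χ(S) = χ(uS) = χ(S)`
    have hfib : ∀ F : G → ℂ, (∀ s, F s ∈ Finset.univ.image fun t : G => χ (Additive.ofMul t)) →
        ∑ s ∈ Φ, F s = ∑ v ∈ Finset.univ.image (fun t : G => χ (Additive.ofMul t)),
          ((Φ.filter fun s => F s = v).card : ℂ) * v := by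
      intro F hF
      rw [← Finset.sum_fiberwise_of_maps_to (g := F) fun s _ => hF s]
      refine Finset.sum_congr rfl fun v _ => ?_
      rw [Finset.sum_congr rfl fun s hs => by rw [(Finset.mem_filter.1 hs).2], Finset.sum_const, nsmul_eq_mul]
    have hT : ∑ s ∈ Φ, χ (Additive.ofMul s) = ∑ v ∈ Finset.univ.image (fun t : G => χ (Additive.ofMul t)),
        ((Φ.filter fun s => χ (Additive.ofMul s) = v).card : ℂ) * v :=
      hfib _ fun s => Finset.mem_image.2 ⟨s, Finset.mem_univ _, rfl⟩
    have hTu : ∑ s ∈ Φ, χ (Additive.ofMul (s * u)) = ∑ v ∈ Finset.univ.image (fun t : G => χ (Additive.ofMul t)),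
        ((Φ.filter fun s => χ (Additive.ofMul (s * u)) = v).card : ℂ) * v :=
      hfib _ fun s => Finset.mem_image.2 ⟨s * u, Finset.mem_univ _, rfl⟩
    have hcount : ∀ v ∈ Finset.univ.image (fun t : G => χ (Additive.ofMul t)),
        (Φ.filter fun s => χ (Additive.ofMul (s * u)) = v).card = (Φ.filter fun s => χ (Additive.ofMul s) = v).card := by
      intro v hv
      obtain ⟨g₀, -, rfl⟩ := Finset.mem_image.1 hv
      have hg : χ (Additive.ofMul g₀) = χ (Additive.ofMul (g₀ * u⁻¹)) * χ (Additive.ofMul u) := by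
        rw [← char_mul₄ₚ, inv_mul_cancel_right]
      have key := hE (g₀ * u⁻¹)
      rw [← hg] at key
      rw [key]
      congr 1
      refine Finset.filter_congr fun s _ => ?_
      rw [char_mul₄ₚ, hg]
      exact ⟨fun h' => mul_right_cancel₀ (char_ne_zero₄ₚ χ u) h', fun h' => by rw [h']⟩
    have hωT : (∑ s ∈ Φ, χ (Additive.ofMul s)) * χ (Additive.ofMul u) = ∑ s ∈ Φ, χ (Additive.ofMul s) := by
      rw [Finset.sum_mul, Finset.sum_congr rfl fun s _ => (char_mul₄ₚ χ s u).symm, hTu, hT]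
      exact Finset.sum_congr rfl fun v hv => by rw [hcount v hv]
    have : (∑ s ∈ Φ, χ (Additive.ofMul s)) * (χ (Additive.ofMul u) - 1) = 0 := by
      rw [mul_sub, mul_one, hωT, sub_self]
    exact (mul_eq_zero.1 this).resolve_right (sub_ne_zero.2 hω1)

end Values

/-! ## §2 Kernels of index `4p`: the characters of a cyclic quotient of order `4p` vanish iff the type is equidistributed
along the `p`-torsion -/

section IndexFourMulPrime

variable [hp : Fact p.Prime]

omit [Fintype G] [DecidableEq G] hp in
/-- `χ(g)^{[G : ker χ]} = 1`. [folklore] -/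
private theorem char_pow_index_eq_one₄ₚ [Finite G] {H : Subgroup G} (χ : AddChar (Additive G) ℂ)
    (hker : ∀ g : G, χ (Additive.ofMul g) = 1 ↔ g ∈ H) (g : G) : χ (Additive.ofMul g) ^ H.index = 1 := by
  rw [← char_pow₄ₚ, hker]
  exact Subgroup.pow_index_mem H g

omit [Fintype G] [DecidableEq G] hp in
/-- A character whose kernel misses the involution `ρ` is odd. [folklore] -/
private theorem odd_of_ker₄ₚ {H : Subgroup G} (hρH : ρ ∉ H) (hρ2 : ρ * ρ = 1) (χ : AddChar (Additive G) ℂ)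
    (hker : ∀ g : G, χ (Additive.ofMul g) = 1 ↔ g ∈ H) : χ (Additive.ofMul ρ) = -1 := by
  have hsq : χ (Additive.ofMul ρ) * χ (Additive.ofMul ρ) = 1 := by rw [← char_mul₄ₚ, hρ2, char_one₄ₚ]
  rcases mul_self_eq_one_iff.1 hsq with h1 | h1
  · exact absurd ((hker ρ).1 h1) hρH
  · exact h1

omit [Fintype G] [DecidableEq G] in
/-- For `ker χ` of index `4p` with cyclic quotient, the fourth power of a generator has `χ`-value a primitive `p`-th root of
unity. [folklore] -/
private theorem exists_isPrimitiveRoot_of_index_four_mul [Finite G] {H : Subgroup G} (χ : AddChar (Additive G) ℂ)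
    (hker : ∀ g : G, χ (Additive.ofMul g) = 1 ↔ g ∈ H) (hidx : H.index = 4 * p) (hcyc : IsCyclic (G ⧸ H)) :
    ∃ u : G, IsPrimitiveRoot (χ (Additive.ofMul u)) p := by
  haveI := hcyc
  obtain ⟨γ, hγ⟩ := IsCyclic.exists_generator (α := G ⧸ H)
  obtain ⟨σ, rfl⟩ := QuotientGroup.mk_surjective γ
  have hσN : orderOf (σ : G ⧸ H) = 4 * p := by
    rw [orderOf_eq_card_of_forall_mem_zpowers hγ, ← Subgroup.index_eq_card, hidx]
  have hprim : IsPrimitiveRoot (χ (Additive.ofMul σ)) (4 * p) := by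
    rw [IsPrimitiveRoot.iff_def]
    have hk : ∀ k : ℕ, χ (Additive.ofMul σ) ^ k = 1 ↔ 4 * p ∣ k := fun k => by
      rw [← char_pow₄ₚ, hker, ← QuotientGroup.eq_one_iff, QuotientGroup.mk_pow, ← hσN, orderOf_dvd_iff_pow_eq_one]
    exact ⟨(hk _).2 dvd_rfl, fun l hl => (hk l).1 hl⟩
  refine ⟨σ ^ 4, ?_⟩
  rw [char_pow₄ₚ]
  exact hprim.pow (mul_pos four_pos hp.out.pos) rfl

/-- **VANISHING AT A KERNEL OF INDEX `4p` IS EQUIDISTRIBUTION ALONG THE `p`-TORSION** (any finite abelian group `G`, `p` odd):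
an odd character `χ` whose kernel `H` has index `4p` and cyclic quotient vanishes on the CM type `S` iff
`#(S ∩ gxH) = #(S ∩ gH)` for every `g ∈ G` and every `x` with `x^p ∈ H` — the same condition as at the kernels of index `2p`
(tree `sum_char_eq_zero_iff_equidistributed_of_index`): on `G/H ≅ ℤ/4p = ℤ/4 × ℤ/p` the type's coset counts must be constant
along the `ℤ/p`-direction.  On a CM field: the characters belonging to a CM subfield `F` of degree `4p` with CYCLIC `Gal(F/ℚ)`
vanish on the type iff the multiplicities of `Φ|_F` are constant along the orbits of the order-`p` subgroup of `Gal(F/ℚ)`.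
[cite: Kubota1965, §4 Lemma 2] [cite: Hazama2003CyclicCM, Prop. 4.3 and Lemma 4.6.1] [cite: Washington1997, Prop. 2.4 and Thm. 2.5] -/
theorem sum_char_eq_zero_iff_equidistributed_of_index_four_mul (hp2 : p ≠ 2) (h : IsCMTypeWith ρ (Φ : Set G))
    (χ : AddChar (Additive G) ℂ) (hχ : χ (Additive.ofMul ρ) = -1) {H : Subgroup G}
    (hker : ∀ g : G, χ (Additive.ofMul g) = 1 ↔ g ∈ H) (hidx : H.index = 4 * p) (hcyc : IsCyclic (G ⧸ H)) :
    ∑ s ∈ Φ, χ (Additive.ofMul s) = 0 ↔ ∀ x : G, x ^ p ∈ H → ∀ g : G,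
      (Φ.filter fun s => (g * x)⁻¹ * s ∈ H).card = (Φ.filter fun s => g⁻¹ * s ∈ H).card := by
  obtain ⟨u, hu⟩ := exists_isPrimitiveRoot_of_index_four_mul χ hker hidx hcyc
  have hall : ∀ g : G, χ (Additive.ofMul g) ^ (4 * p) = 1 := fun g => by
    rw [← hidx]; exact char_pow_index_eq_one₄ₚ χ hker g
  rw [sum_char_eq_zero_iff_fibres_four_mul hp2 h hχ hu hall]
  -- coset counts versus fibre counts
  have hcos : ∀ g : G, (Φ.filter fun s => g⁻¹ * s ∈ H) =
      Φ.filter fun s => χ (Additive.ofMul s) = χ (Additive.ofMul g) := fun g =>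
    Finset.filter_congr fun s _ => (char_eq_iff_inv_mul_mem₄ₚ χ hker g s).symm
  constructor
  · intro crit x hx g
    have iter : ∀ (i : ℕ) (g : G),
        (Φ.filter fun s => χ (Additive.ofMul s) = χ (Additive.ofMul g) * χ (Additive.ofMul u) ^ i).card =
          (Φ.filter fun s => χ (Additive.ofMul s) = χ (Additive.ofMul g)).card := by
      intro i
      induction i with
      | zero => intro g; simp only [pow_zero, mul_one]
      | succ i ih =>
        intro g
        have hval : χ (Additive.ofMul g) * χ (Additive.ofMul u) ^ (i + 1) =
            χ (Additive.ofMul (g * u ^ i)) * χ (Additive.ofMul u) := by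
          rw [char_mul₄ₚ, char_pow₄ₚ, pow_succ, mul_assoc]
        rw [hval, crit (g * u ^ i), char_mul₄ₚ, char_pow₄ₚ]
        exact ih g
    have hxp : χ (Additive.ofMul x) ^ p = 1 := by rw [← char_pow₄ₚ, hker]; exact hx
    obtain ⟨i, -, hi⟩ := hu.eq_pow_of_pow_eq_one hxp
    have key := iter i g
    rw [hi, ← char_mul₄ₚ, ← hcos, ← hcos] at key
    exact key
  · intro hEQ g
    have hx : u ^ p ∈ H := by rw [← hker, char_pow₄ₚ]; exact hu.pow_eq_one
    have key := hEQ u hx g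
    rw [hcos, hcos, char_mul₄ₚ] at key
    exact key

omit [DecidableEq G] in
/-- **All characters of an index-`4p` kernel at once**: for `H ∌ ρ` with `G/H` cyclic of order `4p`, the characters with kernel
`H` vanish on `S` iff `S` is equidistributed along the `p`-torsion at `H` (so `H` contributes `φ(4p) = 2(p−1)` to Kubota's defect iff
so). [cite: Kubota1965, §4 Lemma 2] [cite: Hazama2003CyclicCM, Prop. 4.3] [cite: White1993SporadicCycles, §4, proof of Lemma 3 (p. 131)] -/
theorem forall_sum_char_eq_zero_iff_equidistributed_of_index_four_mul (hp2 : p ≠ 2) (h : IsCMTypeWith ρ (Φ : Set G))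
    {H : Subgroup G} (hρH : ρ ∉ H) (hcyc : IsCyclic (G ⧸ H)) (hidx : H.index = 4 * p) :
    (∀ χ : AddChar (Additive G) ℂ, (∀ g : G, χ (Additive.ofMul g) = 1 ↔ g ∈ H) →
        ∑ s ∈ Φ, χ (Additive.ofMul s) = 0) ↔
      ∀ x : G, x ^ p ∈ H → ∀ g : G,
        (Φ.filter fun s => (g * x)⁻¹ * s ∈ H).card = (Φ.filter fun s => g⁻¹ * s ∈ H).card := by
  have hρ2 := rho_mul_rho₄ₚ h
  rw [forall_sum_char_eq_zero_iff_exists hρH hρ2 hcyc Φ]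
  constructor
  · rintro ⟨ψ, hψ, h0⟩
    exact (sum_char_eq_zero_iff_equidistributed_of_index_four_mul hp2 h ψ (odd_of_ker₄ₚ hρH hρ2 ψ hψ) hψ hidx hcyc).1 h0
  · intro hEQ
    obtain ⟨χ, hχρ, hker⟩ := exists_oddChar_ker hρH hρ2 hcyc
    exact ⟨χ, hker, (sum_char_eq_zero_iff_equidistributed_of_index_four_mul hp2 h χ hχρ hker hidx hcyc).2 hEQ⟩

end IndexFourMulPrime

end AbelianKernels

end CyclicCMType

end Literature.NumberTheory.ComplexMultiplication

end
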